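import Literature.Probability.LatticeModels.AnisotropicPlaneRotatorLRO
import Literature.Probability.LatticeModels.LatticeGreenThreeCertificate
import HarnessLib

/-!
# The classical XY model on `ℤ³` orders at `T = (π/2)·J`: the interlayer-grammar caveat «K4 fails at isotropy»,
# proved in the comparison model (Fröhlich–Simon–Spencer floor × the certified Watson constant `R(3) < 0.51`)

Topic `Literature/Probability/LatticeModels`, namespace `Literature.Probability.LatticeModels.AnisotropicRotator`.
The tree holds the Fröhlich–Simon–Spencer infrared-bound floor for the plane rotator on `(ℤ/Lℤ)³` in
thermodynamic-limit form (`AnisotropicPlaneRotatorLRO.lean`: for couplings `K_i ≥ J > 0` and every `ε > 0`,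
for all large even `L`, `L⁻⁶∑_{x,y}⟨cos(θ_x − θ_y)⟩_K ≥ 1 − latticeGreen 0/J − ε`; Friedli–Velenik 2017 Thm. 10.25
with `J₀ = latticeGreen 0 = (2π)⁻³∫d³p/∑ᵢ(1 − cos pᵢ)`, Watson's constant `0.505462…` [FriedliVelenikSMLS2017]).
Until now `J₀` carried no kernel number; `LatticeGreenThreeCertificate.lean` certifies
`0.4902 ≤ latticeGreen (0 : Site 3) ≤ 0.5094 < 0.51`. Consequences, all for the CLASSICAL comparison model:

* `isotropic_plateau_ge_decimal` — for every `J > 0` and `ε > 0`, for all large even `L`: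
  `plateau L (J,J,J) ≥ 1 − 0.5094/J − ε`; ORIENTATIONAL LONG-RANGE ORDER for every `J > 0.5094`, i.e. an
  ordering FLOOR `T_c^{XY}(ℤ³) ≥ J/0.5094 = 1.963·J` for the isotropic model (Monte Carlo: `2.202·J` [float];
  the Aizenman–Simon ceiling of `PlaneRotatorAizenmanSimonWindow.lean` is `½T_c^{Is}(ℤ³) ≈ 2.256·J` [float]);
* **`isotropic_plateau_ge_at_pi_div_two`** — at the Nelson–Kosterlitz temperature `T = (π/2)·J` (coupling
  `J/T = 2/π = 0.6366 > 0.51`): `plateau L (2/π) ≥ 0.19 − ε` for all large even `L` — **the isotropic classical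
  XY model on `ℤ³` is ORDERED at `T = (π/2)·J`**;
* `layered_plateau_ge_at_pi_div_two` — the same for the LAYERED model `(J∥, J∥, J⊥)` at `T = (π/2)·J∥` whenever
  `J⊥ ≥ (9/10)·J∥` (plateau `≥ 1/10 − ε`; Ginibre comparison with the isotropic model at `J⊥`, so the
  anisotropy threshold `9/10` is crude — the anisotropic infrared constant `C(r)` of
  `AnisotropicPlaneRotatorLROInfrared.lean` would lower it, but carries no kernel number).

Cell reading (`pub/hubbard-tc`, MO-S3, ASSUMPTIONS §0 key K4 «`T_c^{3D} ≤ (1 + η)·T_KT` and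
`(1 + η)·T_KT ≤ (π/2)·J(0)` on the material's anisotropy range (fails for isotropic 3D: sc-XY `T_c = 2.20·J > (π/2)·J`
[float])»): the parenthetical caveat is now a KERNEL sentence about the comparison model — at `J⊥ ≥ 0.9·J∥` the
layered classical XY model is ordered at `T = (π/2)·J∥`, so no «`T_c ≤ (π/2)·J∥`» reading can hold there; the
material rows of record (cuprates, `J⊥/J∥ ≲ 10⁻³`) are untouched. CONTEXT ONLY: no material row, no kelvin, no
number of record moves.

## References

* J. Fröhlich, B. Simon, T. Spencer, Comm. Math. Phys. 50 (1976) 79–95 (infrared bounds), via S. Friedli,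
  Y. Velenik, *Statistical Mechanics of Lattice Systems*, CUP (2017), Thm. 10.25, (10.40)–(10.42)
  [FriedliVelenikSMLS2017].
* J. Ginibre, Comm. Math. Phys. 16 (1970) 310–328, Prop. 3 with Example 4 [Ginibre1970].
* G. N. Watson, Quart. J. Math. 10 (1939) 266–276 (the simple cubic integral), via A. J. Guttmann, J. Phys. A 43
  (2010) 305205, §2.1 [Guttmann2010].
-/

noncomputable section

open MeasureTheory Set Filter Finset Real
open scoped BigOperators

namespace Literature.Probability.LatticeModels

namespace AnisotropicRotator

/-! ## §1 The isotropic floor with the certified constant -/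

/-- **The Fröhlich–Simon–Spencer floor with Watson's constant certified**: for `J > 0` and `ε > 0`, for all
large even `L`, the torus plateau of the isotropic classical XY model on `(ℤ/Lℤ)³` at coupling `J` (inverse
temperature absorbed) obeys `L⁻⁶∑_{x,y}⟨cos(θ_x − θ_y)⟩ ≥ 1 − 0.5094/J − ε`. Long-range order for every
`J > 0.5094` (`T_c^{XY}(ℤ³) ≥ 1.963·J` as a floor).
[cite: FriedliVelenikSMLS2017, Thm 10.25 with (10.41)–(10.42)] -/
theorem isotropic_plateau_ge_decimal {J : ℝ} (hJ : 0 < J) {ε : ℝ} (hε : 0 < ε) :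
    ∃ L₀ : ℕ, ∀ (L : ℕ) [NeZero L], L₀ ≤ L → Even L → 4 ≤ L →
      1 - 5094 / 10000 / J - ε ≤ plateau L (fun _ => J) := by
  obtain ⟨L₀, hL₀⟩ := longRangeOrder_of_le (K := fun _ => J) hJ (fun _ => le_rfl) hε
  refine ⟨L₀, fun L _ hL0 hLe hL4 => (le_trans ?_ (hL₀ L hL0 hLe hL4))⟩
  have hG := latticeGreen_three_zero_mem_Icc.2
  have : latticeGreen (0 : Site 3) / J ≤ 5094 / 10000 / J := div_le_div_of_nonneg_right hG hJ.le
  linarith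

/-- **Temperature form of the floor**: for `J > 0` and `0 < T` with `0.5094·T < J` (i.e. `T < 1.963·J`), the
isotropic classical XY model at inverse temperature `1/T` (coupling `J/T`) has plateau
`≥ 1 − 0.5094·T/J − ε > 0` for all large even `L`. [cite: FriedliVelenikSMLS2017, Thm 10.25 with (10.41)–(10.42)] -/
theorem isotropic_plateau_ge_of_temperature {J T : ℝ} (hJ : 0 < J) (hT : 0 < T) {ε : ℝ} (hε : 0 < ε) :
    ∃ L₀ : ℕ, ∀ (L : ℕ) [NeZero L], L₀ ≤ L → Even L → 4 ≤ L →
      1 - 5094 / 10000 * T / J - ε ≤ plateau L (fun _ => J / T) := by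
  obtain ⟨L₀, hL₀⟩ := isotropic_plateau_ge_decimal (div_pos hJ hT) hε
  refine ⟨L₀, fun L _ hL0 hLe hL4 => (le_of_eq ?_).trans (hL₀ L hL0 hLe hL4)⟩
  field_simp

/-! ## §2 Order at the Nelson–Kosterlitz temperature `T = (π/2)·J` -/

/-- `0.5094 · π/2 ≤ 0.81` (from `π < 3.15`). [folklore] -/
private theorem decimal_mul_pi_div_two_le : (5094 / 10000 : ℝ) / (2 / π) ≤ 81 / 100 := by
  have hπ := Real.pi_lt_d2
  have hπ0 := Real.pi_pos
  rw [div_div_eq_mul_div]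
  rw [div_le_iff₀ (by norm_num : (0 : ℝ) < 2)]
  nlinarith

/-- **The isotropic classical XY model on `ℤ³` is ordered at `T = (π/2)·J`.** At coupling `J/T = 2/π`
(`≈ 0.6366 > 0.51 > latticeGreen 0`) the torus plateau satisfies, for every `ε > 0` and all large even `L`,
`L⁻⁶∑_{x,y}⟨cos(θ_x − θ_y)⟩_{2/π} ≥ 0.19 − ε` — orientational long-range order at the temperature where a
two-dimensional universal-jump reading would place the CEILING `(π/2)·J`. The `J⊥ = J∥` endpoint of the cell's
K4 caveat, as a kernel sentence about the comparison model.
[cite: FriedliVelenikSMLS2017, Thm 10.25 with (10.41)–(10.42)] -/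
theorem isotropic_plateau_ge_at_pi_div_two {ε : ℝ} (hε : 0 < ε) :
    ∃ L₀ : ℕ, ∀ (L : ℕ) [NeZero L], L₀ ≤ L → Even L → 4 ≤ L →
      19 / 100 - ε ≤ plateau L (fun _ => 2 / π) := by
  have h2π : (0 : ℝ) < 2 / π := div_pos two_pos Real.pi_pos
  obtain ⟨L₀, hL₀⟩ := isotropic_plateau_ge_decimal h2π hε
  refine ⟨L₀, fun L _ hL0 hLe hL4 => le_trans ?_ (hL₀ L hL0 hLe hL4)⟩
  linarith [decimal_mul_pi_div_two_le]

/-! ## §3 The layered model near isotropy -/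

/-- `0.5094/(r·2/π) ≤ 0.9` for `r ≥ 9/10` (from `π < 3.15`). [folklore] -/
private theorem decimal_div_layered_le {r : ℝ} (hr : 9 / 10 ≤ r) :
    (5094 / 10000 : ℝ) / (r * (2 / π)) ≤ 9 / 10 := by
  have hπ := Real.pi_lt_d2
  have hπ0 := Real.pi_pos
  have hr0 : 0 < r := by linarith
  rw [div_le_iff₀ (by positivity)]
  have h1 : (5094 / 10000 : ℝ) ≤ 9 / 10 * (9 / 10 * (2 / π)) := by
    rw [show (9 / 10 : ℝ) * (9 / 10 * (2 / π)) = 81 / 50 / π by ring, le_div_iff₀ hπ0]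
    nlinarith
  refine h1.trans ?_
  have h2 : 9 / 10 * (2 / π) ≤ r * (2 / π) := mul_le_mul_of_nonneg_right hr (div_pos two_pos hπ0).le
  nlinarith

/-- **The layered classical XY model `(J∥, J∥, J⊥)` with `J⊥ ≥ (9/10)·J∥` is ordered at `T = (π/2)·J∥`**: at
couplings `(2/π, 2/π, r·2/π)` with `9/10 ≤ r ≤ 1`, for every `ε > 0` and all large even `L`, the plateau is
`≥ 1/10 − ε` (Ginibre comparison with the isotropic model at the interlayer coupling `r·2/π ≥ 0.573 > 0.5094`;
the anisotropy threshold is crude). No «`T_c^{3D} ≤ (π/2)·J∥`» reading of the comparison model survives at such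
anisotropies; the cell's material rows (`J⊥/J∥ ≲ 10⁻³`) are not concerned.
[cite: Ginibre1970, Prop. 3 with Example 4] [cite: FriedliVelenikSMLS2017, Thm 10.25 with (10.41)–(10.42)] -/
theorem layered_plateau_ge_at_pi_div_two {r : ℝ} (hr : 9 / 10 ≤ r) (hr1 : r ≤ 1) {ε : ℝ} (hε : 0 < ε) :
    ∃ L₀ : ℕ, ∀ (L : ℕ) [NeZero L], L₀ ≤ L → Even L → 4 ≤ L →
      1 / 10 - ε ≤ plateau L (layeredCoupling (2 / π) (r * (2 / π))) := by
  have h2π : (0 : ℝ) < 2 / π := div_pos two_pos Real.pi_pos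
  have hr0 : 0 < r := by linarith
  have hperp : 0 < r * (2 / π) := mul_pos hr0 h2π
  have hle : r * (2 / π) ≤ 2 / π := by nlinarith
  obtain ⟨L₀, hL₀⟩ := layered_longRangeOrder hperp hle hε
  refine ⟨L₀, fun L _ hL0 hLe hL4 => le_trans ?_ (hL₀ L hL0 hLe hL4)⟩
  have hG := latticeGreen_three_zero_mem_Icc.2
  have h1 : latticeGreen (0 : Site 3) / (r * (2 / π)) ≤ 5094 / 10000 / (r * (2 / π)) :=
    div_le_div_of_nonneg_right hG hperp.le
  linarith [decimal_div_layered_le hr]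

end AnisotropicRotator

end Literature.Probability.LatticeModels

end
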